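import Summits.ResolutionOfSingularities.ResolutionOfSingularities.Theorems.UniversalCellsCampaignW82RootTowerAlgebra
import Mathlib.FieldTheory.RatFunc.AsPolynomial
import HarnessLib

/-!
# [OURS · L1 W8.2] THE `p`-TH ROOT TOWER OF `t` OVER `M(t)`, `M` PERFECT: the tower exists in every perfect extension,
# its union `K_∞ = K(t^{1/p^∞})` is perfect, and finite subsets of `K_∞` live at a finite level

Cell `res-hironaka` (run/shared/lean/pub/res-hironaka/), LADDER-RESOLUTION rung L (RESCUE), slot W8.2; host route
`UniversalCells`, host item `PrimeFieldToPerfect` (stmt-ResolutionOfSingularities-15233), door 1. Proofs file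
(Theses-free, field theory only), written by res-L1-s82-pv-1 (gen 5); second half of the algebra for the
regular-twist criterion (`…RootTowerAlgebra.lean`: levels `Kₙ = K⟮θ n⟯`, `θ (n+1)^p = θ n`, `θ 0 = t`).

* `exists_rootTower` — in a perfect `L ⊇ K = M(t)` a root tower exists (`θ (n+1) = Frob⁻¹ (θ n)`).
* `exists_aeval_pow_eq_aeval`, `algebraMap_comp_polynomial_eq_aeval` — for `M` perfect, `P(θ n)` is the `p`-th power
  of `P̃(θ (n+1))`, `P̃` the polynomial with the `p`-th roots of the coefficients of `P`; the structure map
  `M[X] → M(X) → L` is evaluation at `θ 0 = t`.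
* `exists_pow_eq_of_mem_adjoin_range_rootTower`, **`perfectField_adjoin_range_rootTower`** — for `M` perfect the
  union `K_∞ = K(θ₀, θ₁, …) ⊆ L` of the tower is a PERFECT field (field induction: scalars `f(t)/g(t)` have the
  `p`-th roots `f̃(θ₁)/g̃(θ₁)`, generators `θ n` the roots `θ (n+1)`).
* `exists_level_of_finset_subset` — every finite subset of `K_∞` lies in one level `Kₙ` (any `M`).

HONEST FRAMING. OURS lemmas (role replaced: §17 ¶2 p.89 l.59–62 of [Hironaka2017], typed AS PRINTED as
`S17Methodology.U89_3`); NOT statements of the manuscript; elementary field theory. AI work, weaker than expert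
review; no claim beyond the kernel.
-/

noncomputable section

set_option linter.dupNamespace false -- mandated namespace of this single-conjunct summit

open Polynomial IntermediateField

namespace Summit.ResolutionOfSingularities.ResolutionOfSingularities.Theorems.CampaignW82

/-! ## The tower in a perfect extension, and the perfect union `K_∞` -/

section Perfect

variable {p : ℕ} [Fact p.Prime] {M : Type} [Field M] [CharP M p] {L : Type} [Field L] [Algebra (RatFunc M) L]

/-- **A root tower exists in every perfect extension of `M(t)`**: `θ 0 = t`, `θ (n+1) = (θ n)^{1/p}`.
[folklore] -/
theorem exists_rootTower [PerfectField L] :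
    ∃ θ : ℕ → L, θ 0 = algebraMap (RatFunc M) L RatFunc.X ∧ ∀ n, θ (n + 1) ^ p = θ n := by
  have hp : p.Prime := Fact.out
  haveI : CharP L p := charP_of_injective_algebraMap (algebraMap (RatFunc M) L).injective p
  haveI : ExpChar L p := ExpChar.prime hp
  haveI : PerfectRing L p := PerfectField.toPerfectRing p
  have hroot : ∀ y : L, ((frobeniusEquiv L p).symm y) ^ p = y := fun y => by
    rw [← frobenius_def]
    exact (frobeniusEquiv L p).apply_symm_apply y
  refine ⟨fun n => ((frobeniusEquiv L p).symm)^[n] (algebraMap (RatFunc M) L RatFunc.X), rfl, fun n => ?_⟩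
  dsimp only
  rw [Function.iterate_succ_apply', hroot]

variable [PerfectField M] (θ : ℕ → L) (hθ0 : θ 0 = algebraMap (RatFunc M) L RatFunc.X)
  (hθ : ∀ n, θ (n + 1) ^ p = θ n)

include hθ0 hθ

omit hθ0 in
/-- The `p`-th root of a polynomial value along the tower: for `P ∈ M[X]` there is `Q ∈ M[X]` (coefficients the
`p`-th roots of those of `P`, `M` perfect) with `Q(θ (n+1))^p = P(θ n)`. [folklore] -/
theorem exists_aeval_pow_eq_aeval (P : M[X]) (n : ℕ) :
    letI : Algebra M L := ((algebraMap (RatFunc M) L).comp (algebraMap M (RatFunc M))).toAlgebra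
    ∃ Q : M[X], (aeval (θ (n + 1)) Q) ^ p = aeval (θ n) P := by
  have hp : p.Prime := Fact.out
  letI : Algebra M L := ((algebraMap (RatFunc M) L).comp (algebraMap M (RatFunc M))).toAlgebra
  haveI : ExpChar M p := ExpChar.prime hp
  haveI : CharP L p := charP_of_injective_algebraMap (algebraMap (RatFunc M) L).injective p
  haveI : ExpChar L p := ExpChar.prime hp
  haveI : PerfectRing M p := PerfectField.toPerfectRing p
  refine ⟨P.map (frobeniusEquiv M p).symm.toRingHom, ?_⟩
  have hmap : (P.map (frobeniusEquiv M p).symm.toRingHom).map (frobenius M p) = P := by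
    rw [Polynomial.map_map]
    have : (frobenius M p).comp (frobeniusEquiv M p).symm.toRingHom = RingHom.id M := by
      ext x
      change frobenius M p ((frobeniusEquiv M p).symm x) = x
      rw [← frobeniusEquiv_apply, RingEquiv.apply_symm_apply]
    rw [this, Polynomial.map_id]
  rw [← map_pow, ← Polynomial.map_frobenius_expand, Polynomial.map_expand, hmap, Polynomial.expand_aeval, hθ n]

omit [Fact p.Prime] [CharP M p] [PerfectField M] hθ in
/-- The composite structure map `M[X] → M(X) → L` is evaluation at `θ 0 = t`. [folklore] -/
theorem algebraMap_comp_polynomial_eq_aeval :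
    letI : Algebra M L := ((algebraMap (RatFunc M) L).comp (algebraMap M (RatFunc M))).toAlgebra
    ∀ P : M[X], algebraMap (RatFunc M) L (algebraMap M[X] (RatFunc M) P) = aeval (θ 0) P := by
  letI : Algebra M L := ((algebraMap (RatFunc M) L).comp (algebraMap M (RatFunc M))).toAlgebra
  intro P
  have key : ((algebraMap (RatFunc M) L).comp (algebraMap M[X] (RatFunc M))) =
      (aeval (θ 0) : M[X] →ₐ[M] L).toRingHom := by
    refine Polynomial.ringHom_ext (fun c => ?_) ?_
    · change algebraMap (RatFunc M) L (algebraMap M[X] (RatFunc M) (Polynomial.C c)) = aeval (θ 0) (Polynomial.C c)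
      rw [aeval_C, RatFunc.algebraMap_C, ← RatFunc.algebraMap_eq_C]
      rfl
    · change algebraMap (RatFunc M) L (algebraMap M[X] (RatFunc M) X) = aeval (θ 0) X
      rw [aeval_X, RatFunc.algebraMap_X, hθ0]
  exact congrFun (congrArg DFunLike.coe key) P

/-- **The union `K_∞ = K(θ₀, θ₁, …)` of the tower is relatively perfect** (`M` perfect): every element has a
`p`-th root in it. Field induction: the generators `θ n` have the roots `θ (n+1)`; a scalar `f(t)/g(t) ∈ K` has the
root `f̃(θ₁)/g̃(θ₁)` (`exists_aeval_pow_eq_aeval`); sums, products and inverses of `p`-th powers are `p`-th powers.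
[folklore] -/
theorem exists_pow_eq_of_mem_adjoin_range_rootTower {x : L}
    (hx : x ∈ IntermediateField.adjoin (RatFunc M) (Set.range θ)) :
    ∃ y ∈ IntermediateField.adjoin (RatFunc M) (Set.range θ), y ^ p = x := by
  classical
  have hp : p.Prime := Fact.out
  haveI : CharP L p := charP_of_injective_algebraMap (algebraMap (RatFunc M) L).injective p
  letI : Algebra M L := ((algebraMap (RatFunc M) L).comp (algebraMap M (RatFunc M))).toAlgebra
  haveI : IsScalarTower M (RatFunc M) L := IsScalarTower.of_algebraMap_eq fun _ => rfl
  set E := IntermediateField.adjoin (RatFunc M) (Set.range θ) with hE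
  -- polynomial values at `θ 1` lie in `E`
  have hmemθ : ∀ n, θ n ∈ E := fun n => IntermediateField.subset_adjoin _ _ ⟨n, rfl⟩
  haveI : ExpChar L p := ExpChar.prime hp
  have haeval : ∀ Q : M[X], aeval (θ 1) Q ∈ E := fun Q => by
    have h := SetLike.coe_mem (aeval (⟨θ 1, hmemθ 1⟩ : E) Q)
    rw [← IntermediateField.aeval_coe E] at h
    exact h
  refine IntermediateField.adjoin_induction (RatFunc M) (p := fun x _ => ∃ y ∈ E, y ^ p = x) ?_ ?_ ?_ ?_ ?_ hx
  · rintro _ ⟨n, rfl⟩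
    exact ⟨θ (n + 1), hmemθ (n + 1), hθ n⟩
  · intro c
    obtain ⟨Qn, hQn⟩ := exists_aeval_pow_eq_aeval θ hθ c.num 0
    obtain ⟨Qd, hQd⟩ := exists_aeval_pow_eq_aeval θ hθ c.denom 0
    refine ⟨aeval (θ 1) Qn / aeval (θ 1) Qd, div_mem (haeval Qn) (haeval Qd), ?_⟩
    rw [div_pow, hQn, hQd, ← algebraMap_comp_polynomial_eq_aeval θ hθ0,
      ← algebraMap_comp_polynomial_eq_aeval θ hθ0, ← map_div₀, RatFunc.num_div_denom]
  · rintro x y - - ⟨u, hu, rfl⟩ ⟨v, hv, rfl⟩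
    exact ⟨u + v, add_mem hu hv, add_pow_char u v p⟩
  · rintro x - ⟨u, hu, rfl⟩
    exact ⟨u⁻¹, inv_mem hu, inv_pow u p⟩
  · rintro x y - - ⟨u, hu, rfl⟩ ⟨v, hv, rfl⟩
    exact ⟨u * v, mul_mem hu hv, mul_pow u v p⟩

/-- **`K_∞` is a perfect field** (`M` perfect). [folklore] -/
theorem perfectField_adjoin_range_rootTower :
    PerfectField (IntermediateField.adjoin (RatFunc M) (Set.range θ)) := by
  have hp : p.Prime := Fact.out
  haveI : CharP L p := charP_of_injective_algebraMap (algebraMap (RatFunc M) L).injective p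
  set E := IntermediateField.adjoin (RatFunc M) (Set.range θ)
  haveI : CharP E p := (algebraMap E L).charP (algebraMap E L).injective p
  haveI : ExpChar E p := ExpChar.prime hp
  haveI : PerfectRing E p := PerfectRing.ofSurjective E p fun x => by
    obtain ⟨y, hy, hyx⟩ := exists_pow_eq_of_mem_adjoin_range_rootTower θ hθ0 hθ x.2
    exact ⟨⟨y, hy⟩, Subtype.ext (by rw [frobenius_def]; exact hyx)⟩
  exact PerfectRing.toPerfectField E p

omit [Fact p.Prime] [CharP M p] [PerfectField M] hθ0 in
/-- **Every finite subset of `K_∞` lies in one level `Kₙ`.** [folklore] -/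
theorem exists_level_of_finset_subset (s : Finset L)
    (hs : (↑s : Set L) ⊆ IntermediateField.adjoin (RatFunc M) (Set.range θ)) :
    ∃ n : ℕ, (↑s : Set L) ⊆ (RatFunc M)⟮θ n⟯ := by
  classical
  have hsup : IntermediateField.adjoin (RatFunc M) (Set.range θ) = ⨆ n, (RatFunc M)⟮θ n⟯ := by
    rw [← IntermediateField.biSup_adjoin_simple, iSup_range]
  -- each element lies in one level
  have hone : ∀ x ∈ IntermediateField.adjoin (RatFunc M) (Set.range θ), ∃ n, x ∈ (RatFunc M)⟮θ n⟯ := by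
    intro x hx
    rw [hsup] at hx
    obtain ⟨t, ht⟩ := IntermediateField.exists_finset_of_mem_iSup hx
    refine ⟨t.sup id, ?_⟩
    have hle : (⨆ i ∈ t, (RatFunc M)⟮θ i⟯) ≤ (RatFunc M)⟮θ (t.sup id)⟯ :=
      iSup₂_le fun i hi => level_mono θ hθ (Finset.le_sup (f := id) hi)
    exact hle ht
  choose! n hn using hone
  refine ⟨s.sup n, fun x hx => ?_⟩
  exact level_mono θ hθ (Finset.le_sup (f := n) hx) (hn x (hs hx))

end Perfect

end Summit.ResolutionOfSingularities.ResolutionOfSingularities.Theorems.CampaignW82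

end
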